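import Summits.BirchSwinnertonDyer.BirchSwinnertonDyer.Theorems.AlignedTransportAtTwoMainConjectureOfRankZeroBSDAtTwoResolventLambdaParity
import Literature.NumberTheory.IwasawaTheory.ImaginaryQuadraticTwoTowerRootsOfUnity
import HarnessLib

/-!
# Route `AlignedTransportAtTwo`, crux C2 `MainConjectureOfRankZeroBSDAtTwo` (stmt-BirchSwinnertonDyer-22298):
# the resolvent's `λ₂` is EXACT and UNCONDITIONAL on `Δ_W = −d·q²`, `d ≡ 3 (mod 4)` — g29's parity theorems WITHOUT the Ferrero–Kida hypothesis

HONEST FRAMING (cell `bsd-f1-sign2`, WIDTH-5 attached prover seat `bsd-line-att-p3` gen 31, line `birth`, lead `bsd-line-att-p2`; `--supports`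
stmt-BirchSwinnertonDyer-22298, closes nothing; BSD is NOT proved; the crux C2, its verdict «blocked-on `Rank1Residual.GreenbergMuConjectureIrreducible`» and every
registered stub are untouched).  g29's file `…ResolventLambdaParity` took the named fact `ferreroKida_classicalLambda_two_imaginaryQuadratic` as a hypothesis `hFK`.
This seat proved that fact on its `d ≡ 3 (mod 4)` half (`Literature.NumberTheory.IwasawaTheory.ferreroKida_of_sq_eq_neg`: no capitulation in the tower, explicit
Hilbert 90, exponent descent, `λ =` eventual `2`-rank; `ImaginaryQuadraticTwoTower{NoCapitulation,LambdaOfRootsOfUnity,RootsOfUnity}`).  Here the `hFK`-theorems are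
re-derived WITHOUT `hFK` under `d % 4 = 3` — automatic on the Kilford sub-cell (`d ≡ 7 (mod 8)`):

* `odd_classicalLambda_iff` — `K ∋ √−d`, `d ≡ 3 (4)` squarefree: `μ₂(K) = 0`, `λ₂(K) + 1 = Σ_{p∣d} 2^{ord₂(p²−1)−3}` and `λ₂(K)` odd iff `d ≡ 7 (mod 8)`.
* `odd_classicalLambda_divisionField_two_iff` — `Δ_W = −d·q²`, `d ≡ 3 (4)`: granted `μ₂(ℚ(W[2])) = 0`, `λ₂(ℚ(W[2]))` odd iff `d ≡ 7 (mod 8)`.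
* ★ `odd_classicalLambda_divisionField_two_of_onKilfordStratumAtTwo` — ON the Kilford stratum (`d ≡ 7 (8)`): `λ₂(ℚ(W[2]))` is ODD, unconditionally in `hFK`.
* ★ `classicalLambda_eq_three_of_rankCert_le_four` — a `2`-rank certificate of value `≤ 4` pins `λ₂(ℚ(W[2])^{cyc}) = 3` (Kilford sub-cell), unconditionally in `hFK`.
* ★ `ferreroKidaSum_le_classicalLambda_divisionField_two_succ` — `Σ_{p∣d} 2^{ord₂(p²−1)−3} ≤ λ₂(ℚ(W[2])) + 1` for `d ≡ 3 (4)` (7831a1: `≥ 17`; 24213c1: `≥ 33`),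
  unconditionally in `hFK`.

References: Ferrero 1980 [Ferrero1980AJM]; Kida 1979 [Kida1979Tohoku]; Schettler 2014 Thm. 2 [Schettler2014]; Washington 1997 Thm. 10.8, §13.3; Fukuda 1994 Thm. 1.
-/

-- single-conjunct summit: the mandated namespace `Summit.BirchSwinnertonDyer.BirchSwinnertonDyer.…` repeats the summit name (D-0017)
set_option linter.dupNamespace false

noncomputable section

open scoped Classical NumberField

namespace Summit.BirchSwinnertonDyer.BirchSwinnertonDyer.Theorems.AlignedTransportAtTwoResolventLambdaExact

open Polynomial WeierstrassCurve IntermediateField Field NumberField Finset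
  Literature.NumberTheory.EllipticCurves Literature.NumberTheory.EllipticCurves.Greenberg1999 Literature.NumberTheory.GaloisRepresentations
  Literature.NumberTheory.IwasawaTheory Literature.NumberTheory.NumberFields
  Summit.BirchSwinnertonDyer.Rank1Residual.F1Sign2
  Summit.BirchSwinnertonDyer.BirchSwinnertonDyer.Theorems.AlignedTransportAtTwoKilfordStratumShared
  Summit.BirchSwinnertonDyer.BirchSwinnertonDyer.Theorems.AlignedTransportAtTwoKilfordStratum
  Summit.BirchSwinnertonDyer.BirchSwinnertonDyer.Theorems.AlignedTransportAtTwoResolventParity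
  Summit.BirchSwinnertonDyer.BirchSwinnertonDyer.Theorems.AlignedTransportAtTwoRankCertificateLambda
  Summit.BirchSwinnertonDyer.BirchSwinnertonDyer.Theorems.AlignedTransportAtTwoResolventLambdaParity

/-! ## §1 Imaginary quadratic `K ∋ √−d`, `d ≡ 3 (mod 4)`: the exact `λ₂` and its parity, unconditionally -/

/-- ★ **`μ₂(K) = 0`, `λ₂(K) + 1 = Σ_{p∣d, p odd} 2^{ord₂(p²−1)−3}`, and `λ₂(K)` ODD iff `d ≡ ±1 (mod 8)`** for `K` quadratic with `δ² = −d`, `d ≡ 3 (mod 4)` squarefree,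
`κ` any cyclotomic `ℤ₂`-extension — UNCONDITIONAL (this seat's `ferreroKida_of_sq_eq_neg`). [cite: Schettler2014, Thm. 2] [cite: Ferrero1980AJM, Thm.] -/
theorem odd_classicalLambda_iff {K : Type} [Field K] [NumberField K] {d : ℕ} (hd : Squarefree d) (hd4 : d % 4 = 3)
    (hK : Module.finrank ℚ K = 2) (hδ : ∃ δ : K, δ ^ 2 = -((d : ℕ) : K)) (κ : ZpExtension K 2) (hκ : κ.IsCyclotomic) :
    ClassicalMuVanishes κ ∧ classicalLambda κ + 1 = ∑ p ∈ d.primeFactors.erase 2, 2 ^ (padicValNat 2 (p ^ 2 - 1) - 3) ∧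
      (Odd (classicalLambda κ) ↔ (d % 8 = 1 ∨ d % 8 = 7)) := by
  obtain ⟨hμ, hl⟩ := ferreroKida_of_sq_eq_neg K hK hd hd4 hδ κ hκ
  have hodd : Odd d := Nat.odd_iff.mpr (by omega)
  refine ⟨hμ, hl, ?_⟩
  rw [← ferreroKidaSum_mod_two_eq_zero_iff hd hodd, ← hl, Nat.odd_iff]
  omega

variable (W : WeierstrassCurve ℚ) [W.IsElliptic]

/-- ★ **The resolvent road, unconditionally**: `Δ_W = −d·q²` (`d ≡ 3 (mod 4)` squarefree, `q ∈ ℚˣ`), `δ² = Δ_W`, `κ` / `κT` cyclotomic `ℤ₂`-extensions of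
`ℚ(δ)` / `ℚ(W[2])`; granted `μ₂(ℚ(W[2])) = 0`: `μ₂(ℚ(√−d)) = 0`, `λ₂(ℚ(√−d))` odd iff `d ≡ ±1 (8)`, and **`λ₂(ℚ(W[2]))` odd iff `d ≡ ±1 (mod 8)`** (g29's resolvent parity
law + this seat's unconditional Ferrero–Kida). [cite: Schettler2014, Thm. 2] [cite: Washington1997, Thm. 10.8 and §13.3 Thm. 13.13] -/
theorem odd_classicalLambda_divisionField_two_iff {d : ℕ} (hd : Squarefree d) (hd4 : d % 4 = 3) {q : ℚ} (hq : q ≠ 0)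
    (hΔ : W.Δ = -(d : ℚ) * q ^ 2) {δ : AlgebraicClosure ℚ} (hδ : δ ^ 2 = ((W.Δ : ℚ) : AlgebraicClosure ℚ)) (κ : ZpExtension ℚ⟮δ⟯ 2) (hκ : κ.IsCyclotomic)
    (κT : ZpExtension (W.divisionField 2) 2) (hκT : κT.IsCyclotomic) (hμ : ClassicalMuVanishes κT) :
    (ClassicalMuVanishes κ ∧ (Odd (classicalLambda κ) ↔ (d % 8 = 1 ∨ d % 8 = 7))) ∧
      (Odd (classicalLambda κT) ↔ (d % 8 = 1 ∨ d % 8 = 7)) := by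
  have h2 : 2 < d := by omega
  have hδint : IsIntegral ℚ δ := ((AlgebraicClosure.isAlgebraic ℚ).isAlgebraic δ).isIntegral
  haveI : FiniteDimensional ℚ ℚ⟮δ⟯ := IntermediateField.adjoin.finiteDimensional hδint
  haveI : NumberField ℚ⟮δ⟯ := NumberField.mk
  obtain ⟨hK2, hη⟩ := exists_sq_eq_neg_of_sq_eq W h2 hq hΔ hδ
  obtain ⟨hμk, -, hk⟩ := odd_classicalLambda_iff hd hd4 hK2 hη κ hκ
  obtain ⟨-, -, hpar⟩ := classicalLambda_divisionField_two_modEq_two_resolvent W (not_isSquare_Δ_of_eq_neg_mul_sq W h2 hq hΔ) hδ κ hκ κT hκT hμ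
  refine ⟨⟨hμk, hk⟩, ?_⟩
  rw [← hk, Nat.odd_iff, Nat.odd_iff]
  have : classicalLambda κT % 2 = classicalLambda κ % 2 := hpar
  omega

/-- ★ **`λ₂(ℚ(W[2])^{cyc})` is ODD on the Kilford sub-cell, UNCONDITIONALLY in Ferrero–Kida** — `W/ℚ` elliptic ON the Kilford stratum with `Δ_W = −d·q²` (`d` odd
squarefree, so `d ≡ 7 (mod 8)`), `κT` any cyclotomic `ℤ₂`-extension of `ℚ(W[2])` with `μ = 0` (the C2 input).  Also `μ₂(ℚ(√Δ_W)) = 0` and `λ₂(ℚ(√Δ_W))` odd.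
[cite: Schettler2014, Thm. 2] [cite: Washington1997, Thm. 10.8] -/
theorem odd_classicalLambda_divisionField_two_of_onKilfordStratumAtTwo (hs : OnKilfordStratumAtTwo W) {d : ℕ} (hd : Squarefree d) (hodd : Odd d)
    {q : ℚ} (hq : q ≠ 0) (hΔ : W.Δ = -(d : ℚ) * q ^ 2)
    {δ : AlgebraicClosure ℚ} (hδ : δ ^ 2 = ((W.Δ : ℚ) : AlgebraicClosure ℚ)) (κ : ZpExtension ℚ⟮δ⟯ 2) (hκ : κ.IsCyclotomic)
    (κT : ZpExtension (W.divisionField 2) 2) (hκT : κT.IsCyclotomic) (hμ : ClassicalMuVanishes κT) :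
    ClassicalMuVanishes κ ∧ Odd (classicalLambda κ) ∧ Odd (classicalLambda κT) := by
  have h7 := AlignedTransportAtTwoResolventLambdaParity.mod_eight_eq_seven_of_onKilfordStratumAtTwo W hs hodd hq hΔ
  have hd4 : d % 4 = 3 := by omega
  obtain ⟨⟨hμk, hk⟩, hT⟩ := odd_classicalLambda_divisionField_two_iff W hd hd4 hq hΔ hδ κ hκ κT hκT hμ
  exact ⟨hμk, hk.mpr (Or.inr h7), hT.mpr (Or.inr h7)⟩

/-- ★ **A 2-rank certificate of value `≤ 4` pins `λ₂(ℚ(W[2])^{cyc}) = 3` on the Kilford sub-cell, UNCONDITIONALLY in Ferrero–Kida** (g28's sandwich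
`3 ≤ λ₂(T) ≤ r` + oddness of `λ₂(T)`). [cite: Fukuda1994, Thm. 1 (2), p. 264] [cite: Schettler2014, Thm. 2] -/
theorem classicalLambda_eq_three_of_rankCert_le_four (ht : ∀ x : ℚ, ¬ HasRationalTwoTorsionX W x) (hs : OnKilfordStratumAtTwo W)
    {d : ℕ} (hd : Squarefree d) (hodd : Odd d) (h2 : 2 < d) {q : ℚ} (hq : q ≠ 0) (hΔ : W.Δ = -(d : ℚ) * q ^ 2)
    {δ : AlgebraicClosure ℚ} (hδ : δ ^ 2 = ((W.Δ : ℚ) : AlgebraicClosure ℚ))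
    (κT : ZpExtension (W.divisionField 2) 2) (hκT : κT.IsCyclotomic)
    {n : ℕ} (hcert : classGroupPRank κT (n + 1) = classGroupPRank κT n) (h4 : classGroupPRank κT n ≤ 4) :
    classicalLambda κT = 3 := by
  have hΔneg : W.Δ < 0 := by
    rw [hΔ]
    have hq2 : 0 < q ^ 2 := by positivity
    have hdpos : (0 : ℚ) < d := by exact_mod_cast (by omega : 0 < d)
    nlinarith
  haveI : Fact (Nat.Prime 2) := ⟨Nat.prime_two⟩
  have hδint : IsIntegral ℚ δ := ((AlgebraicClosure.isAlgebraic ℚ).isAlgebraic δ).isIntegral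
  haveI : FiniteDimensional ℚ ℚ⟮δ⟯ := IntermediateField.adjoin.finiteDimensional hδint
  haveI : NumberField ℚ⟮δ⟯ := NumberField.mk
  obtain ⟨κ, hκ⟩ := ZpExtension.exists_isCyclotomic_holds ℚ⟮δ⟯ 2 (GaloisRep.cyclotomicCharacter_range_infinite ℚ⟮δ⟯ 2)
  obtain ⟨hμT, h3, hle⟩ := three_le_classicalLambda_and_le_of_rankCert_divisionField_two W ht hΔneg hs κT hκT hcert
  obtain ⟨-, -, hoddT⟩ := odd_classicalLambda_divisionField_two_of_onKilfordStratumAtTwo W hs hd hodd hq hΔ hδ κ hκ κT hκT hμT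
  obtain ⟨m, hm⟩ := hoddT
  omega

/-- ★ **`Σ_{p ∣ d, p odd} 2^{ord₂(p²−1)−3} ≤ λ₂(ℚ(W[2])^{cyc}) + 1`, UNCONDITIONALLY in Ferrero–Kida** — `Δ_W = −d·q²` (`d ≡ 3 (mod 4)` squarefree, `q ∈ ℚˣ`), `δ² = Δ_W`,
`κT` any cyclotomic `ℤ₂`-extension of `ℚ(W[2])` with `μ = 0`: the left side IS `λ₂(ℚ(√−d)) + 1` (this seat) and `λ₂(ℚ(√Δ_W)) ≤ λ₂(ℚ(W[2]))` (g29).  Census: 7831a1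
(`d = 7831`) `λ₂(T) ≥ 17`; 24213c1 (`d = 8071`) `λ₂(T) ≥ 33`. [cite: Schettler2014, Thm. 2] [cite: Washington1997, §13.3 Thm. 13.13] -/
theorem ferreroKidaSum_le_classicalLambda_divisionField_two_succ {d : ℕ} (hd : Squarefree d) (hd4 : d % 4 = 3) {q : ℚ} (hq : q ≠ 0)
    (hΔ : W.Δ = -(d : ℚ) * q ^ 2) {δ : AlgebraicClosure ℚ} (hδ : δ ^ 2 = ((W.Δ : ℚ) : AlgebraicClosure ℚ))
    (κT : ZpExtension (W.divisionField 2) 2) (hκT : κT.IsCyclotomic) (hμ : ClassicalMuVanishes κT) :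
    ∑ p ∈ d.primeFactors.erase 2, 2 ^ (padicValNat 2 (p ^ 2 - 1) - 3) ≤ classicalLambda κT + 1 := by
  have h2 : 2 < d := by omega
  haveI : Fact (Nat.Prime 2) := ⟨Nat.prime_two⟩
  have hδint : IsIntegral ℚ δ := ((AlgebraicClosure.isAlgebraic ℚ).isAlgebraic δ).isIntegral
  haveI : FiniteDimensional ℚ ℚ⟮δ⟯ := IntermediateField.adjoin.finiteDimensional hδint
  haveI : NumberField ℚ⟮δ⟯ := NumberField.mk
  obtain ⟨κ, hκ⟩ := ZpExtension.exists_isCyclotomic_holds ℚ⟮δ⟯ 2 (GaloisRep.cyclotomicCharacter_range_infinite ℚ⟮δ⟯ 2)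
  obtain ⟨hK2, hη⟩ := exists_sq_eq_neg_of_sq_eq W h2 hq hΔ hδ
  obtain ⟨-, hsum⟩ := ferreroKida_of_sq_eq_neg ℚ⟮δ⟯ hK2 hd hd4 hη κ hκ
  obtain ⟨-, hle, -⟩ := classicalLambda_divisionField_two_modEq_two_resolvent W (not_isSquare_Δ_of_eq_neg_mul_sq W h2 hq hΔ) hδ κ hκ κT hκT hμ
  rw [← hsum]
  exact Nat.add_le_add_right hle 1

end Summit.BirchSwinnertonDyer.BirchSwinnertonDyer.Theorems.AlignedTransportAtTwoResolventLambdaExact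

end
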